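import Literature.NumberTheory.EllipticCurves.WeierstrassConjugateThreeTorsionProofs
import Mathlib.AlgebraicGeometry.EllipticCurve.IsomOfJ
import HarnessLib

/-!
# [IUTchIV] Proposition 1.8 (iv) in real form: two models with rational `l`-torsion are isomorphic

`Proofs` file (theorems only; no definitions, no named facts, no instances) in topic
`NumberTheory/EllipticCurves`, companion of `WeierstrassConjugateThreeTorsionProofs` (transport of
points along a field homomorphism; rigidity of Weierstrass automorphisms on `3`-torsion),
`WeierstrassAutFixedTorsionProofs` (a non-trivial Weierstrass automorphism fixes only `2`- and
`3`-torsion) and `TorsionCardinality` (`#E[n] = n²`). Written by the cell `abc-iut` (seat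
abc-iut-L5-t12) as the REAL form — for Weierstrass equations over a field — of

> S. Mochizuki, *Inter-universal Teichmüller theory IV*, Prop. 1.8 (iv) (kurims Apr-2020 manuscript,
> p. 19): "In the situation of (ii), suppose further that `l ≥ 3` is a prime number that is
> invertible in `k`, and that `E_k̄` descends to elliptic curves `E′_k` and `E″_k` over `k`, all of
> whose `l`-torsion points are rational over `k`. Then `E′_k` is isomorphic to `E″_k` over `k`."

The content is classical ("we review some well-known elementary facts concerning elliptic curves",
loc. cit. p. 18). The series uses it in [IUTchIV] Thm. 1.10 (p. 22) and Cor. 2.2 (ii) (p. 42) —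
"it follows from Proposition 1.8, (iv), that `E_F ≅ E_{F_tpd} ×_{F_tpd} F` over `F`" (with `l = 3`)
— and in [IUTchI] Rmk. 3.1.5. The tree types Prop. 1.8 only over an abstract interface
(`Literature.IUT.LogVolume.Prop18.TorsionSetting.P18_iv`); here it is PROVED for Weierstrass curves.

## Statement proved

Let `k ⊆ L` be fields with `L` algebraically closed and `L/k` Galois (e.g. `L` an algebraic closure
of a perfect `k`), `char k ∤ 6`, `l ≥ 3` a prime invertible in `k`, and `W₁`, `W₂` Weierstrass
curves over `k`, `W₁` elliptic, that become isomorphic over `L` (`C • W₁/L = W₂/L` for a change of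
variables `C` over `L`; equivalently both elliptic with `j(W₁) = j(W₂)`). If every `l`-torsion point
of `W₁(L)` and of `W₂(L)` is fixed by `Aut(L/k)` (which is what "rational over `k`" gives,
`Affine.Point.map_algEquiv_eq_self_of_mem_range`), then `C₀ • W₁ = W₂` for a change of variables
`C₀` over `k`: `exists_variableChange_of_torsion_fixed`, `exists_variableChange_of_j_eq_of_torsion_fixed`,
and the `Γ_k`-module phrasing over `AlgebraicClosure k`,
`exists_variableChange_of_j_eq_of_geomTorsion_fixed`.

## Proof (Silverman *AEC* X.2 twisting principle, made explicit)

For `σ ∈ Aut(L/k)` the conjugate `σ(C)` again carries `W₁/L` to `W₂/L`, so `A_σ := C⁻¹σ(C)` is an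
automorphism of `W₁/L`; on an `l`-torsion point `T` (fixed by `σ`, with `C(T) ∈ W₂[l]` fixed by `σ`)
`A_σ(T) = C⁻¹(σ(C)(σT)) = C⁻¹(σ(C T)) = C⁻¹(C T) = T` (`congrEquiv_pointEquiv_conj_eq_self`). A
Weierstrass automorphism fixing `E[l]` pointwise is trivial (`l ≥ 5`: a non-trivial one fixes no
non-zero point of order prime to `6`, tree `eq_zero_of_fixed_of_prime_pow_nsmul_eq_zero`, while
`#E[l] = l² > 1`; `l = 3`: tree `eq_one_of_three_torsion_fixed` with `exists_three_torsion_pair`),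
so `σ(C) = C` for all `σ` (`map_algEquiv_eq_of_torsion_fixed`); by Galois descent for ELEMENTS
(Mathlib `InfiniteGalois.mem_range_algebraMap_iff_fixed`) `C = C₀/L` with `C₀` over `k`, and
`C₀ • W₁ = W₂` because base change of equations along a field extension is injective.

## References

* [Mochizuki2012] S. Mochizuki, IUT IV, Prop. 1.8 (iv) p. 19; Thm. 1.10 p. 22; Cor. 2.2 p. 42.
* [SilvermanAEC2009] J. H. Silverman, *The Arithmetic of Elliptic Curves*, 2nd ed.: III.1 Table 3.1,
  III.3.1(b), Cor. III.6.4(b), Thm. III.10.1, X.2 (twisting principle), X.5.4.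

## Design

Pure theorems, `open scoped Classical` as in the companion files; deliberate dot-notation extensions
of Mathlib's `WeierstrassCurve` namespace. Fields `k : Type u`, `L : Type v` in independent
universes; the Galois action is written `Affine.Point.map (σ : L →ₐ[k] L)` (= the tree's `σ • P` of
`GaloisAction`, `smul_def`, when `L = AlgebraicClosure k`). No definitions. Axioms: `propext`,
`Classical.choice`, `Quot.sound`.
-/

noncomputable section

open scoped Classical

universe u v

namespace WeierstrassCurve

open Literature.NumberTheory.EllipticCurves

/-! ## §1. The cocycle `σ ↦ C⁻¹σ(C)` of a change of variables over `L` between curves over `k` -/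

section Cocycle

variable {k : Type u} {L : Type v} [Field k] [Field L] [Algebra k L]
  {W₁ W₂ : WeierstrassCurve k} {C : VariableChange L} (σ : L ≃ₐ[k] L)

/-- For `σ ∈ Aut(L/k)` and a Weierstrass equation `W` over `k`, the conjugate equation of `W/L` is
`W/L` itself: `(W/L)^σ = W/L` (Mathlib `map_baseChange`; private plumbing). [folklore] -/
private theorem baseChange_map_algEquiv (W : WeierstrassCurve k) :
    (W.baseChange L).map ((σ : L →ₐ[k] L) : L →+* L) = W.baseChange L :=
  W.map_baseChange (σ : L →ₐ[k] L)

/-- A point of `W(L)` with coordinates in `k` is fixed by `Aut(L/k)` ("rational over `k`" implies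
"Galois-fixed", the form in which rationality is used below; the easy inclusion `E(k) ⊆ E(k̄)^{G_k}`
of Silverman *AEC* VIII.§1). [cite: SilvermanAEC2009, VIII.§1 (proof of Prop. 1.2)] -/
theorem Affine.Point.map_algEquiv_eq_self_of_mem_range {W : WeierstrassCurve k} {x y : L}
    (h : (W.baseChange L).toAffine.Nonsingular x y) (hx : x ∈ Set.range (algebraMap k L))
    (hy : y ∈ Set.range (algebraMap k L)) :
    Affine.Point.map (σ : L →ₐ[k] L) (.some x y h) = .some x y h := by
  obtain ⟨x₀, rfl⟩ := hx
  obtain ⟨y₀, rfl⟩ := hy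
  rw [Affine.Point.map_some]
  simp only [AlgHom.commutes]

/-- A point of `W(L)` in the image of `W(k)` is fixed by `Aut(L/k)` (Mathlib `map_baseChange`; the
easy inclusion `E(k) ⊆ E(k̄)^{G_k}` of Silverman *AEC* VIII.§1).
[cite: SilvermanAEC2009, VIII.§1 (proof of Prop. 1.2)] -/
theorem Affine.Point.map_algEquiv_eq_self_of_mem_range_baseChange {W : WeierstrassCurve k}
    {T : (W.baseChange L).toAffine.Point}
    (hT : T ∈ Set.range (Affine.Point.baseChange (W' := W.toAffine) k L)) :
    Affine.Point.map (σ : L →ₐ[k] L) T = T := by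
  obtain ⟨P, rfl⟩ := hT
  exact Affine.Point.map_baseChange (σ : L →ₐ[k] L) P

/-- If `C • W₁/L = W₂/L` for equations `W₁, W₂` over `k` and `σ ∈ Aut(L/k)`, then the conjugate
change of variables does the same: `σ(C) • W₁/L = W₂/L` (Silverman *AEC* X.2: `Aut(L/k)` acts on
the isomorphisms between two `k`-curves). [cite: SilvermanAEC2009, X.2 (the twisting principle)] -/
theorem VariableChange.map_algEquiv_smul_baseChange (hC : C • W₁.baseChange L = W₂.baseChange L) :
    C.map ((σ : L →ₐ[k] L) : L →+* L) • W₁.baseChange L = W₂.baseChange L := by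
  have h := map_variableChange (W₁.baseChange L) C ((σ : L →ₐ[k] L) : L →+* L)
  rw [baseChange_map_algEquiv, hC, baseChange_map_algEquiv] at h
  exact h

/-- The cocycle `A_σ := C⁻¹ σ(C)` is an automorphism of `W₁/L`: `A_σ • W₁/L = W₁/L`.
[cite: SilvermanAEC2009, X.2 (the twisting principle)] -/
theorem VariableChange.inv_mul_map_algEquiv_smul (hC : C • W₁.baseChange L = W₂.baseChange L) :
    (C⁻¹ * C.map ((σ : L →ₐ[k] L) : L →+* L)) • W₁.baseChange L = W₁.baseChange L := by
  rw [mul_smul, VariableChange.map_algEquiv_smul_baseChange σ hC, ← hC, inv_smul_smul]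

/-- **The cocycle fixes every point whose image is Galois-fixed.** With `e_C : W₁(L) ≃ W₂(L)` the
isomorphism of `C • W₁/L = W₂/L`: if `σ ∈ Aut(L/k)` fixes `T ∈ W₁(L)` and fixes `e_C(T) ∈ W₂(L)`,
then the automorphism `A_σ = C⁻¹σ(C)` of `W₁/L` fixes `T` — the computation
`A_σ(T) = C⁻¹(σ(C)(σ T)) = C⁻¹(σ(C T)) = C⁻¹(C T) = T` of the twisting principle.
[cite: SilvermanAEC2009, X.2 (the twisting principle)] -/
theorem VariableChange.congrEquiv_pointEquiv_conj_eq_self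
    (hC : C • W₁.baseChange L = W₂.baseChange L)
    (hA : (C⁻¹ * C.map ((σ : L →ₐ[k] L) : L →+* L)) • W₁.baseChange L = W₁.baseChange L)
    {T : (W₁.baseChange L).toAffine.Point} (hT : Affine.Point.map (σ : L →ₐ[k] L) T = T)
    (heT : Affine.Point.map (σ : L →ₐ[k] L)
        (Affine.Point.congrEquiv hC (VariableChange.pointEquiv (W₁.baseChange L) C T)) =
      Affine.Point.congrEquiv hC (VariableChange.pointEquiv (W₁.baseChange L) C T)) :
    Affine.Point.congrEquiv hA
        (VariableChange.pointEquiv (W₁.baseChange L)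
          (C⁻¹ * C.map ((σ : L →ₐ[k] L) : L →+* L)) T) = T := by
  set σr : L →+* L := ((σ : L →ₐ[k] L) : L →+* L) with hσr_def
  rcases T with _ | ⟨a, b, hab⟩
  · simp only [← Affine.Point.zero_def, map_zero]
  · -- `σ` fixes the coordinates of `T` …
    rw [Affine.Point.map_some, Affine.Point.some.injEq] at hT
    have hσa : σr a = a := hT.1
    have hσb : σr b = b := hT.2
    -- … and those of `e_C(T) = (C.toX a, C.toY a b)`
    rw [VariableChange.pointEquiv_some, Affine.Point.congrEquiv_some, Affine.Point.map_some,
      Affine.Point.some.injEq] at heT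
    have hσX : σr (C.toX a) = C.toX a := heT.1
    have hσY : σr (C.toY a b) = C.toY a b := heT.2
    rw [VariableChange.pointEquiv_some, Affine.Point.congrEquiv_some, Affine.Point.some.injEq]
    constructor
    · calc (C⁻¹ * C.map σr).toX a = C⁻¹.toX ((C.map σr).toX (σr a)) := by
            rw [toX_mul, hσa]
        _ = C⁻¹.toX (σr (C.toX a)) := by rw [← map_toX_ringHom]
        _ = (C⁻¹ * C).toX a := by rw [hσX, toX_mul]
        _ = a := by rw [inv_mul_cancel, toX_one]
    · calc (C⁻¹ * C.map σr).toY a b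
            = C⁻¹.toY ((C.map σr).toX (σr a)) ((C.map σr).toY (σr a) (σr b)) := by
            rw [toY_mul, hσa, hσb]
        _ = C⁻¹.toY (σr (C.toX a)) (σr (C.toY a b)) := by
            rw [← map_toX_ringHom, ← map_toY_ringHom]
        _ = (C⁻¹ * C).toY a b := by rw [hσX, hσY, toY_mul]
        _ = b := by rw [inv_mul_cancel, toY_one]

/-- `e_C` respects `n`-torsion: an `n`-torsion point of `W₁(L)` maps to an `n`-torsion point of
`W₂(L)` under the group isomorphism of `C • W₁/L = W₂/L` (Silverman *AEC* III.3.1(b)).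
[cite: SilvermanAEC2009, III.3.1(b)] -/
theorem VariableChange.zsmul_congrEquiv_pointEquiv_eq_zero
    (hC : C • W₁.baseChange L = W₂.baseChange L) {n : ℤ} {T : (W₁.baseChange L).toAffine.Point}
    (hT : n • T = 0) :
    n • Affine.Point.congrEquiv hC (VariableChange.pointEquiv (W₁.baseChange L) C T) = 0 := by
  rw [← map_zsmul, ← map_zsmul, hT, map_zero, map_zero]

end Cocycle

/-! ## §2. Rigidity: the cocycle of a change of variables respecting rational `l`-torsion is trivial -/

section Rigidity

variable {k : Type u} {L : Type v} [Field k] [Field L] [Algebra k L] [IsAlgClosed L]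
  {W₁ W₂ : WeierstrassCurve k} {C : VariableChange L}

/-- **`σ(C) = C`.** Let `char ∤ 6`, `l ≥ 3` a prime invertible in `L` (algebraically closed),
`W₁` elliptic over `k`, `C • W₁/L = W₂/L`, and `σ ∈ Aut(L/k)` fixing every `l`-torsion point of
`W₁(L)` and of `W₂(L)`. Then the conjugate change of variables `σ(C)` equals `C`. Proof: the
cocycle `A_σ = C⁻¹σ(C)` fixes `W₁[l]` pointwise (`congrEquiv_pointEquiv_conj_eq_self`), and a
Weierstrass automorphism fixing `E[l]` pointwise is `1` — for `l = 3` by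
`eq_one_of_three_torsion_fixed` on a pair of independent `3`-torsion points
(`exists_three_torsion_pair`), for `l ≥ 5` because a non-trivial automorphism fixes no non-zero
point of order a power of a prime `≥ 5` (`eq_zero_of_fixed_of_prime_pow_nsmul_eq_zero`) while
`#E[l] = l² > 1` (`card_torsionBy_eq_sq`). Silverman *AEC* III.10.1 with X.2.
[cite: SilvermanAEC2009, III.10 Thm. 10.1 and X.2] -/
theorem VariableChange.map_algEquiv_eq_of_torsion_fixed [W₁.IsElliptic] (h2 : (2 : L) ≠ 0)
    (h3 : (3 : L) ≠ 0) {l : ℕ} (hl : l.Prime) (hl3 : 3 ≤ l) (hlL : (l : L) ≠ 0)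
    (hC : C • W₁.baseChange L = W₂.baseChange L) (σ : L ≃ₐ[k] L)
    (hfix₁ : ∀ T : (W₁.baseChange L).toAffine.Point, (l : ℤ) • T = 0 →
      Affine.Point.map (σ : L →ₐ[k] L) T = T)
    (hfix₂ : ∀ T : (W₂.baseChange L).toAffine.Point, (l : ℤ) • T = 0 →
      Affine.Point.map (σ : L →ₐ[k] L) T = T) :
    C.map ((σ : L →ₐ[k] L) : L →+* L) = C := by
  haveI : (W₁.baseChange L).IsElliptic := inferInstanceAs (W₁.map (algebraMap k L)).IsElliptic
  have hA := VariableChange.inv_mul_map_algEquiv_smul σ hC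
  -- the cocycle fixes every `l`-torsion point of `W₁(L)`
  have fixA : ∀ T : (W₁.baseChange L).toAffine.Point, (l : ℤ) • T = 0 →
      Affine.Point.congrEquiv hA (VariableChange.pointEquiv (W₁.baseChange L)
        (C⁻¹ * C.map ((σ : L →ₐ[k] L) : L →+* L)) T) = T := fun T hT =>
    VariableChange.congrEquiv_pointEquiv_conj_eq_self σ hC hA (hfix₁ T hT)
      (hfix₂ _ (VariableChange.zsmul_congrEquiv_pointEquiv_eq_zero hC hT))
  suffices hA1 : C⁻¹ * C.map ((σ : L →ₐ[k] L) : L →+* L) = 1 from (inv_mul_eq_one.mp hA1).symm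
  by_cases hl3' : l = 3
  · -- `l = 3`: two independent `3`-torsion points
    subst hl3'
    obtain ⟨Q₁, Q₂, h3Q₁, h3Q₂, hQ₁0, hQ₂0, hne, hne'⟩ :=
      exists_three_torsion_pair (W₁.baseChange L) h3
    have h3Q₁' : ((3 : ℕ) : ℤ) • Q₁ = 0 := by rw [natCast_zsmul]; exact h3Q₁
    have h3Q₂' : ((3 : ℕ) : ℤ) • Q₂ = 0 := by rw [natCast_zsmul]; exact h3Q₂
    exact VariableChange.eq_one_of_three_torsion_fixed (W₁.baseChange L) h2 h3 hA h3Q₁ hQ₁0 hQ₂0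
      hne hne' (fixA Q₁ h3Q₁') (fixA Q₂ h3Q₂')
  · -- `l ≥ 5`: one non-zero `l`-torsion point
    have hl4 : l ≠ 4 := by rintro rfl; exact absurd hl (by decide)
    have hl5 : 5 ≤ l := by omega
    by_contra hA1
    -- `#W₁[l] = l² > 1`, so there is a non-zero `l`-torsion point
    have hcard : Nat.card (AddSubgroup.torsionBy (W₁.baseChange L).toAffine.Point (l : ℤ)) = l ^ 2 :=
      card_torsionBy_eq_sq (E := W₁.baseChange L) hlL
    haveI : Finite (AddSubgroup.torsionBy (W₁.baseChange L).toAffine.Point (l : ℤ)) :=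
      Nat.finite_of_card_ne_zero (by rw [hcard]; positivity)
    have hnt : Nontrivial (AddSubgroup.torsionBy (W₁.baseChange L).toAffine.Point (l : ℤ)) := by
      rw [← Finite.one_lt_card_iff_nontrivial, hcard]
      exact Nat.one_lt_pow two_ne_zero (by omega)
    obtain ⟨⟨Q, hQ⟩, hQ0⟩ := exists_ne (0 : AddSubgroup.torsionBy (W₁.baseChange L).toAffine.Point (l : ℤ))
    have hQ0' : Q ≠ 0 := fun h => hQ0 (Subtype.ext h)
    have hlQ : (l : ℤ) • Q = 0 := (Submodule.mem_torsionBy_iff (l : ℤ) Q).mp hQ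
    have hlQ' : l ^ 1 • Q = 0 := by rw [pow_one, ← natCast_zsmul]; exact hlQ
    exact hQ0' (VariableChange.eq_zero_of_fixed_of_prime_pow_nsmul_eq_zero (W₁.baseChange L) h2 h3
      hA hA1 (fixA Q hlQ) hl hl5 hlQ')

end Rigidity

/-! ## §3. Galois descent of a change of variables -/

section Descent

variable {k : Type u} {L : Type v} [Field k] [Field L] [Algebra k L]
  {W₁ W₂ : WeierstrassCurve k}

/-- A change of variables over `L` fixed by every element of `Aut(L/k)`, `L/k` Galois (possibly
infinite), is defined over `k`: `C = C₀/L` (Galois descent for its four coefficients, Mathlib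
`InfiniteGalois.mem_range_algebraMap_iff_fixed`; the trivial-cocycle case of the twisting
principle, Silverman *AEC* X.2). [cite: SilvermanAEC2009, X.2 (the twisting principle)] -/
theorem VariableChange.exists_map_algebraMap_eq_of_forall_map_algEquiv_eq [IsGalois k L]
    (C : VariableChange L) (h : ∀ σ : L ≃ₐ[k] L, C.map ((σ : L →ₐ[k] L) : L →+* L) = C) :
    ∃ C₀ : VariableChange k, C₀.map (algebraMap k L) = C := by
  have hu : ∀ σ : L ≃ₐ[k] L, σ (C.u : L) = C.u := fun σ => by
    have := congrArg (fun D : VariableChange L => (D.u : L)) (h σ)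
    simpa [VariableChange.map] using this
  have hr : ∀ σ : L ≃ₐ[k] L, σ C.r = C.r := fun σ => by
    have := congrArg VariableChange.r (h σ)
    simpa [VariableChange.map] using this
  have hs : ∀ σ : L ≃ₐ[k] L, σ C.s = C.s := fun σ => by
    have := congrArg VariableChange.s (h σ)
    simpa [VariableChange.map] using this
  have ht : ∀ σ : L ≃ₐ[k] L, σ C.t = C.t := fun σ => by
    have := congrArg VariableChange.t (h σ)
    simpa [VariableChange.map] using this
  obtain ⟨u₀, hu₀⟩ := (InfiniteGalois.mem_range_algebraMap_iff_fixed (C.u : L)).mpr hu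
  obtain ⟨r₀, hr₀⟩ := (InfiniteGalois.mem_range_algebraMap_iff_fixed C.r).mpr hr
  obtain ⟨s₀, hs₀⟩ := (InfiniteGalois.mem_range_algebraMap_iff_fixed C.s).mpr hs
  obtain ⟨t₀, ht₀⟩ := (InfiniteGalois.mem_range_algebraMap_iff_fixed C.t).mpr ht
  have hu₀0 : u₀ ≠ 0 := by
    rintro rfl
    rw [map_zero] at hu₀
    exact C.u.ne_zero hu₀.symm
  refine ⟨⟨Units.mk0 u₀ hu₀0, r₀, s₀, t₀⟩, ?_⟩
  ext
  · simp [VariableChange.map, hu₀]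
  · simp [VariableChange.map, hr₀]
  · simp [VariableChange.map, hs₀]
  · simp [VariableChange.map, ht₀]

/-- **Descent of an isomorphism.** If `C • W₁/L = W₂/L` with `C` fixed by `Aut(L/k)` and `L/k`
Galois, then `C₀ • W₁ = W₂` for a change of variables `C₀` over `k` (base change of Weierstrass
equations along a field extension is injective). [cite: SilvermanAEC2009, X.2 (the twisting principle)] -/
theorem exists_variableChange_eq_of_forall_map_algEquiv_eq [IsGalois k L] {C : VariableChange L}
    (hC : C • W₁.baseChange L = W₂.baseChange L)
    (h : ∀ σ : L ≃ₐ[k] L, C.map ((σ : L →ₐ[k] L) : L →+* L) = C) :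
    ∃ C₀ : VariableChange k, C₀ • W₁ = W₂ := by
  obtain ⟨C₀, hC₀⟩ := VariableChange.exists_map_algebraMap_eq_of_forall_map_algEquiv_eq C h
  refine ⟨C₀, map_injective (algebraMap k L).injective ?_⟩
  change (C₀ • W₁).baseChange L = W₂.baseChange L
  rw [VariableChange.baseChange_smul_eq, hC₀, hC]

end Descent

/-! ## §4. [IUTchIV] Proposition 1.8 (iv) for Weierstrass curves -/

section Main

variable {k : Type u} {L : Type v} [Field k] [Field L] [Algebra k L] [IsAlgClosed L] [IsGalois k L]
  (W₁ W₂ : WeierstrassCurve k) [W₁.IsElliptic]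

/-- **[IUTchIV] Prop. 1.8 (iv), real form (isomorphism given over `L`).** `k ⊆ L` fields, `L`
algebraically closed and Galois over `k`, `char k ∤ 6`, `l ≥ 3` a prime invertible in `k`; `W₁`
(elliptic) and `W₂` Weierstrass curves over `k` with `C • W₁/L = W₂/L`; every `l`-torsion point of
`W₁(L)` and of `W₂(L)` fixed by `Aut(L/k)`. Then `C₀ • W₁ = W₂` for some change of variables `C₀`
over `k`: "`E′_k` is isomorphic to `E″_k` over `k`". [cite: SilvermanAEC2009, X.2 and III.10 Thm. 10.1] -/
theorem exists_variableChange_of_torsion_fixed (h2 : (2 : k) ≠ 0) (h3 : (3 : k) ≠ 0) {l : ℕ}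
    (hl : l.Prime) (hl3 : 3 ≤ l) (hlk : (l : k) ≠ 0) (C : VariableChange L)
    (hC : C • W₁.baseChange L = W₂.baseChange L)
    (hfix₁ : ∀ (σ : L ≃ₐ[k] L) (T : (W₁.baseChange L).toAffine.Point), (l : ℤ) • T = 0 →
      Affine.Point.map (σ : L →ₐ[k] L) T = T)
    (hfix₂ : ∀ (σ : L ≃ₐ[k] L) (T : (W₂.baseChange L).toAffine.Point), (l : ℤ) • T = 0 →
      Affine.Point.map (σ : L →ₐ[k] L) T = T) :
    ∃ C₀ : VariableChange k, C₀ • W₁ = W₂ := by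
  have hinj := (algebraMap k L).injective
  have h2L : (2 : L) ≠ 0 := by rw [← map_ofNat (algebraMap k L) 2]; exact (map_ne_zero _).mpr h2
  have h3L : (3 : L) ≠ 0 := by rw [← map_ofNat (algebraMap k L) 3]; exact (map_ne_zero _).mpr h3
  have hlL : (l : L) ≠ 0 := by rw [← map_natCast (algebraMap k L) l]; exact (map_ne_zero _).mpr hlk
  exact exists_variableChange_eq_of_forall_map_algEquiv_eq hC fun σ =>
    VariableChange.map_algEquiv_eq_of_torsion_fixed h2L h3L hl hl3 hlL hC σ (hfix₁ σ) (hfix₂ σ)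

/-- **[IUTchIV] Prop. 1.8 (iv), real form (same `j`-invariant).** `k ⊆ L` fields, `L`
algebraically closed and Galois over `k`, `char k ∤ 6`, `l ≥ 3` a prime invertible in `k`; `W₁`,
`W₂` elliptic curves over `k` with `j(W₁) = j(W₂)` (so that `E_L := W₁/L ≅ W₂/L` "descends to"
both); every `l`-torsion point of `W₁(L)` and of `W₂(L)` fixed by `Aut(L/k)`. Then `C₀ • W₁ = W₂`
for some change of variables `C₀` over `k`. [cite: SilvermanAEC2009, X.2, III.10 Thm. 10.1 and III.1.4(b)] -/
theorem exists_variableChange_of_j_eq_of_torsion_fixed [W₂.IsElliptic] (hj : W₁.j = W₂.j)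
    (h2 : (2 : k) ≠ 0) (h3 : (3 : k) ≠ 0) {l : ℕ} (hl : l.Prime) (hl3 : 3 ≤ l) (hlk : (l : k) ≠ 0)
    (hfix₁ : ∀ (σ : L ≃ₐ[k] L) (T : (W₁.baseChange L).toAffine.Point), (l : ℤ) • T = 0 →
      Affine.Point.map (σ : L →ₐ[k] L) T = T)
    (hfix₂ : ∀ (σ : L ≃ₐ[k] L) (T : (W₂.baseChange L).toAffine.Point), (l : ℤ) • T = 0 →
      Affine.Point.map (σ : L →ₐ[k] L) T = T) :
    ∃ C₀ : VariableChange k, C₀ • W₁ = W₂ := by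
  haveI : (W₁.baseChange L).IsElliptic := inferInstanceAs (W₁.map (algebraMap k L)).IsElliptic
  haveI : (W₂.baseChange L).IsElliptic := inferInstanceAs (W₂.map (algebraMap k L)).IsElliptic
  have hjL : (W₁.baseChange L).j = (W₂.baseChange L).j := by
    change (W₁.map (algebraMap k L)).j = (W₂.map (algebraMap k L)).j
    rw [W₁.map_j, W₂.map_j, hj]
  obtain ⟨C, hC⟩ := exists_variableChange_of_j_eq (W₁.baseChange L) (W₂.baseChange L) hjL
  exact exists_variableChange_of_torsion_fixed W₁ W₂ h2 h3 hl hl3 hlk C hC hfix₁ hfix₂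

end Main

/-! ## §5. The `Γ_k`-module phrasing over `k̄ = AlgebraicClosure k` -/

section Geom

variable {F : Type u} [Field F] [PerfectField F] (W₁ W₂ : WeierstrassCurve F)
  [W₁.IsElliptic] [W₂.IsElliptic]

/-- **[IUTchIV] Prop. 1.8 (iv) in the tree's `Γ_F`-module currency** (`GaloisAction`: `geomPoints`,
`geomTorsion`, the action of `Field.absoluteGaloisGroup F`): over a perfect field `F` with
`char F ∤ 6`, two elliptic curves with the same `j`-invariant on whose geometric `l`-torsion
(`l ≥ 3` prime, invertible in `F`) the absolute Galois group acts trivially are isomorphic over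
`F`. [cite: SilvermanAEC2009, X.2, III.10 Thm. 10.1 and III.1.4(b)] -/
theorem exists_variableChange_of_j_eq_of_geomTorsion_fixed (hj : W₁.j = W₂.j)
    (h2 : (2 : F) ≠ 0) (h3 : (3 : F) ≠ 0) {l : ℕ} (hl : l.Prime) (hl3 : 3 ≤ l) (hlF : (l : F) ≠ 0)
    (hfix₁ : ∀ (σ : Field.absoluteGaloisGroup F) (Q : geomTorsion W₁ (l : ℤ)), σ • Q = Q)
    (hfix₂ : ∀ (σ : Field.absoluteGaloisGroup F) (Q : geomTorsion W₂ (l : ℤ)), σ • Q = Q) :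
    ∃ C₀ : VariableChange F, C₀ • W₁ = W₂ := by
  haveI : IsGalois F (AlgebraicClosure F) := {}
  refine exists_variableChange_of_j_eq_of_torsion_fixed (L := AlgebraicClosure F) W₁ W₂ hj h2 h3
    hl hl3 hlF ?_ ?_
  · intro σ T hT
    have hT' : (T : geomPoints W₁) ∈ geomTorsion W₁ (l : ℤ) :=
      (Submodule.mem_torsionBy_iff (l : ℤ) (T : geomPoints W₁)).mpr hT
    exact congrArg (fun Q : geomTorsion W₁ (l : ℤ) => (Q : geomPoints W₁)) (hfix₁ σ ⟨T, hT'⟩)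
  · intro σ T hT
    have hT' : (T : geomPoints W₂) ∈ geomTorsion W₂ (l : ℤ) :=
      (Submodule.mem_torsionBy_iff (l : ℤ) (T : geomPoints W₂)).mpr hT
    exact congrArg (fun Q : geomTorsion W₂ (l : ℤ) => (Q : geomPoints W₂)) (hfix₂ σ ⟨T, hT'⟩)

end Geom

end WeierstrassCurve
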